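import Mathlib
import Summits.NavierStokesRegularity.NavierStokesRegularity.Theorems.EulerZoomLiouvillePowerGaugeEulerLiouvilleDSSSimilarityDepletion
import Literature.Analysis.FluidPDE.ParticleTrajectoryFlow
import Literature.Analysis.FluidPDE.ParticleTrajectoryFlowJacobian
import Literature.Analysis.FluidPDE.ClassicalSolutionGlue
import Literature.Analysis.ODE.EvolutionMapAutonomous
import HarnessLib.Audit

/-!
# Crux E `PowerGaugeEulerLiouville` (stmt-NavierStokesRegularity-19832): THE RESCALED PERIOD MAP OF A DSS MEMBER — DSS conjugation of the
# particle-trajectory maps, permanent nodes as fixed points, Cauchy's formula and `det = 1` from ANY initial time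
# (width seat ns-cas-k2 g3, lane «DSS thin vortical nodes», tool B part 1)

Route `EulerZoomLiouville` (NavierStokesRegularity), crux E.  Physical variables, g2's conventions (`…DSSSimilarityTools/Nodes`): a classical Euler flow
`u` on `(−∞,0)` with the Cauchy–Lipschitz hypotheses (`ODE.IsUniformlyLipschitzOn u (Iio 0)`, so that `φ(t,t₀,·) = ODE.evolutionMap u t₀ t` are
its particle-trajectory maps), DSS for the class scaling `u(τ,y) = L^{1+ρ}u(L^{2+ρ}τ, Ly)` (`T = L^{2+ρ}`, `n = 1/(2+ρ)`).
* `evolutionMap_dss_conj` — **DSS CONJUGATION OF THE FLOW**: `φ(Tb, Ta, z) = L·φ(b, a, L⁻¹z)` (`a, b < 0`; the curve `s ↦ L·φ(T⁻¹s, a, L⁻¹z)` solves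
  the ODE, uniqueness); `rpow_natPow_comm` — `(lʲ)^{e} = (l^{e})ʲ` for the `j`-fold law;
* `evolutionMap_permanentNode` — a PERMANENT NODE `y*` (`u(t,(−t)ⁿy*) = −n(−t)^{n−1}y*` for all `t < 0`) is carried by the flow:
  `φ(b, a, (−a)ⁿy*) = (−b)ⁿy*`;
* `isUniformlyLipschitzOn_comp_add_right`, `evolutionMap_comp_add_right_eq` — time translation `ũ(t) = u(t + c)`;
* **`curl_evolutionMap_any`** / **`det_fderiv_evolutionMap_any`** — Cauchy's vorticity-transport formula `ω(t, φ(t,t₀,a)) = Dφ(t,t₀,·)(a)·ω(t₀,a)` and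
  `det Dφ(t,t₀,·)(a) = 1` for ANY `t₀, t < 0` (the Literature statements are anchored at the initial time `0 ∈ S`; here `S = (−∞,0)` and the
  anchor is moved by the time translation `comp_add_right`).

WHAT THIS IS NOT: not NS regularity, not the crux E — Lagrangian bookkeeping for hypothetical DSS blow-up members; 19832 is OPEN.
[folklore; MajdaBertozziCUP2002 §1.3 (1.13)–(1.15), §1.6 Prop. 1.8 (1.51); Teschl2012 §1.5 (time shift)]
-/

noncomputable section

set_option linter.dupNamespace false

open MeasureTheory Set Filter Topology Metric Function
open scoped NNReal ENNReal ContDiff InnerProductSpace RealInnerProductSpace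

namespace Summit.NavierStokesRegularity.NavierStokesRegularity.Theorems.PowerGaugeEulerLiouville.DSSNodes

open Literature.Analysis Literature.Analysis.FluidPDE
open Summit.NavierStokesRegularity.NavierStokesRegularity.Theorems.PowerGaugeEulerLiouville.SimilarityBernoulli

variable {u : ℝ → EuclideanSpace ℝ (Fin 3) → EuclideanSpace ℝ (Fin 3)} {p : ℝ → EuclideanSpace ℝ (Fin 3) → ℝ} {ρ l : ℝ}

/-! ### DSS conjugation of the particle-trajectory maps -/

/-- `(lʲ)^e = (l^e)ʲ` for `l ≥ 0`. [folklore] -/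
theorem rpow_natPow_comm (hl : 0 ≤ l) (e : ℝ) (j : ℕ) : (l ^ j) ^ e = (l ^ e) ^ j := by
  rw [← Real.rpow_natCast l j, ← Real.rpow_mul hl, mul_comm, Real.rpow_mul hl, Real.rpow_natCast]

/-- **The `j`-fold DSS law in the one-factor form**: `u(τ,y) = (lʲ)^{1+ρ} u((lʲ)^{2+ρ}τ, lʲy)`. [folklore] -/
theorem dss_pow (hl : 1 < l) (hρ : 0 < 2 + ρ)
    (hdss : ∀ τ : ℝ, τ < 0 → ∀ y, u τ y = (l ^ (1 + ρ)) • u ((l ^ (2 + ρ)) * τ) (l • y)) (j : ℕ) :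
    ∀ τ : ℝ, τ < 0 → ∀ y, u τ y = ((l ^ j) ^ (1 + ρ)) • u (((l ^ j) ^ (2 + ρ)) * τ) ((l ^ j) • y) := by
  intro τ hτ y
  have hl0 : 0 ≤ l := by linarith
  rw [rpow_natPow_comm hl0, rpow_natPow_comm hl0]
  exact dss_iterate hl hρ hdss j hτ y

/-- **DSS CONJUGATION OF THE FLOW.**  If `u(τ,y) = L^{1+ρ}u(Tτ, Ly)` for `τ < 0` (`T = L^{2+ρ}`, `L > 0`) and the trajectories exist on `(−∞,0)`,
then `φ(Tb, Ta, z) = L·φ(b, a, L⁻¹z)` for `a, b < 0`: with a particle path `x(s)`, `L⁻¹x(Ts)` is again a particle path. [folklore] -/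
theorem evolutionMap_dss_conj (hL : ODE.IsUniformlyLipschitzOn u (Iio 0)) {L : ℝ} (hL0 : 0 < L)
    (hdssL : ∀ τ : ℝ, τ < 0 → ∀ y, u τ y = (L ^ (1 + ρ)) • u ((L ^ (2 + ρ)) * τ) (L • y))
    {a b : ℝ} (ha : a < 0) (hb : b < 0) (z : EuclideanSpace ℝ (Fin 3)) :
    ODE.evolutionMap u (L ^ (2 + ρ) * a) (L ^ (2 + ρ) * b) z = L • ODE.evolutionMap u a b (L⁻¹ • z) := by
  set T : ℝ := L ^ (2 + ρ) with hT
  have hT0 : 0 < T := Real.rpow_pos_of_pos hL0 _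
  set γ : ℝ → EuclideanSpace ℝ (Fin 3) := fun s => L • ODE.evolutionMap u a (T⁻¹ * s) (L⁻¹ • z) with hγ
  have hmaps : MapsTo (fun s : ℝ => T⁻¹ * s) (Iio 0) (Iio 0) := fun s hs =>
    mul_neg_of_pos_of_neg (inv_pos.2 hT0) hs
  have hderiv : ∀ s ∈ Iio (0 : ℝ), HasDerivWithinAt γ (u s (γ s)) (Iio 0) s := by
    intro s hs
    have hs' : T⁻¹ * s ∈ Iio (0 : ℝ) := hmaps hs
    have h1 := hL.hasDerivWithinAt_evolutionMap (convex_Iio 0) (mem_Iio.2 ha) hs' (L⁻¹ • z)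
    have h2 : HasDerivWithinAt (fun s : ℝ => T⁻¹ * s) T⁻¹ (Iio 0) s := by
      simpa using (hasDerivWithinAt_id s (Iio 0)).const_mul T⁻¹
    have h3 := (h1.scomp s h2 hmaps).const_smul L
    -- the DSS law turns the derivative into `u s (γ s)`
    set X := ODE.evolutionMap u a (T⁻¹ * s) (L⁻¹ • z) with hX
    have hlaw : u (T⁻¹ * s) X = (L ^ (1 + ρ)) • u s (L • X) := by
      have h := hdssL (T⁻¹ * s) hs' X
      rwa [hT, ← mul_assoc, mul_inv_cancel₀ hT0.ne', one_mul] at h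
    have hcoef : L * T⁻¹ * L ^ (1 + ρ) = 1 := by
      rw [hT, mul_assoc, mul_comm T⁻¹, ← mul_assoc, mul_comm L, rpow_one_add_mul_self hL0, mul_inv_cancel₀ hT0.ne']
    have e : L • T⁻¹ • u (T⁻¹ * s) X = u s (γ s) := by
      rw [hlaw, smul_smul, smul_smul, hcoef, one_smul]
    rw [← e]
    exact h3
  have hTa : T * a ∈ Iio (0 : ℝ) := mul_neg_of_pos_of_neg hT0 ha
  have hTb : T * b ∈ Iio (0 : ℝ) := mul_neg_of_pos_of_neg hT0 hb
  have h := hL.evolutionMap_eq (convex_Iio 0) hTa hderiv hTb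
  have hγa : γ (T * a) = z := by
    simp only [hγ]
    rw [← mul_assoc, inv_mul_cancel₀ hT0.ne', one_mul, ODE.evolutionMap_self, smul_smul, mul_inv_cancel₀ hL0.ne', one_smul]
  have hγb : γ (T * b) = L • ODE.evolutionMap u a b (L⁻¹ • z) := by
    simp only [hγ]
    rw [← mul_assoc, inv_mul_cancel₀ hT0.ne', one_mul]
  rw [hγa] at h
  rw [h, hγb]

/-! ### Permanent nodes are carried by the flow -/

/-- **A permanent node is an exactly self-similar particle path**: if `u(t,(−t)ⁿy*) = −n(−t)^{n−1}y*` for all `t < 0`, then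
`φ(b, a, (−a)ⁿy*) = (−b)ⁿy*` for `a, b < 0`. [folklore] -/
theorem evolutionMap_permanentNode (hL : ODE.IsUniformlyLipschitzOn u (Iio 0)) {n : ℝ} {ys : EuclideanSpace ℝ (Fin 3)}
    (hnode : ∀ t : ℝ, t < 0 → u t ((-t) ^ n • ys) = (-(n * (-t) ^ (n - 1))) • ys) {a b : ℝ} (ha : a < 0) (hb : b < 0) :
    ODE.evolutionMap u a b ((-a) ^ n • ys) = (-b) ^ n • ys := by
  have hderiv : ∀ s ∈ Iio (0 : ℝ), HasDerivWithinAt (fun t : ℝ => (-t) ^ n • ys) (u s ((-s) ^ n • ys)) (Iio 0) s := by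
    intro s hs
    have h1 : HasDerivAt (fun t : ℝ => (-t) ^ n) ((-1) * n * (-s) ^ (n - 1)) s :=
      (hasDerivAt_neg s).rpow_const (Or.inl (by rw [mem_Iio] at hs; linarith))
    have h2 := (h1.smul_const ys).hasDerivWithinAt (s := Iio 0)
    rw [hnode s hs]
    have e : (-(n * (-s) ^ (n - 1))) • ys = ((-1) * n * (-s) ^ (n - 1)) • ys := by ring_nf
    rw [e]
    exact h2
  exact hL.evolutionMap_eq (convex_Iio 0) (mem_Iio.2 ha) hderiv (mem_Iio.2 hb)

/-! ### Time translation: Cauchy's formula and `det = 1` from any initial time -/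

/-- The Cauchy–Lipschitz hypotheses translate in time: `ũ(t) = u(t + c)` on `(−∞, −c)`. [folklore] -/
theorem isUniformlyLipschitzOn_comp_add_right (hL : ODE.IsUniformlyLipschitzOn u (Iio 0)) (c : ℝ) :
    ODE.IsUniformlyLipschitzOn (fun t => u (t + c)) (Iio (-c)) := by
  refine ⟨fun x => ?_, fun C hC hCS => ?_⟩
  · have hmaps : MapsTo (fun t : ℝ => t + c) (Iio (-c)) (Iio 0) := fun t ht => by
      rw [mem_Iio] at ht ⊢; linarith
    exact (hL.continuousOn x).comp (continuous_add_const c).continuousOn hmaps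
  · have hC' : IsCompact ((fun t => t + c) '' C) := hC.image (continuous_add_const c)
    have hCS' : (fun t => t + c) '' C ⊆ Iio 0 := by
      rintro _ ⟨t, ht, rfl⟩; have := hCS ht; rw [mem_Iio] at this ⊢; linarith
    obtain ⟨K, hK⟩ := hL.exists_lipschitzWith hC' hCS'
    exact ⟨K, fun t ht => hK (t + c) ⟨t, ht, rfl⟩⟩

/-- `φ_ũ(t, 0, x) = φ_u(t + c, c, x)` for `ũ(s) = u(s + c)`, `c < 0`, `t + c < 0`. [cite: Teschl2012, §1.5 (time shift)] -/
theorem evolutionMap_comp_add_right_eq (hL : ODE.IsUniformlyLipschitzOn u (Iio 0)) {c t : ℝ} (hc : c < 0) (ht : t + c < 0)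
    (x : EuclideanSpace ℝ (Fin 3)) :
    ODE.evolutionMap (fun s => u (s + c)) 0 t x = ODE.evolutionMap u c (t + c) x := by
  obtain ⟨K, hK⟩ := hL.exists_lipschitzWith_uIcc (convex_Iio 0) (mem_Iio.2 hc) (mem_Iio.2 ht)
  have h := ODE.evolutionMap_comp_add_right (v := u) (t₀ := 0) (t := t) c (K := K) (by simpa using hK) x
  simpa using h

/-- Time translation of a classical Euler flow on `(−∞,0)`: `ũ(t) = u(t + c)` is classical on `(−∞, −c)`. [folklore] -/
theorem isClassicalEulerSolutionOn_comp_add_right (hcl : IsClassicalEulerSolutionOn (Iio 0) 0 u p) (c : ℝ) :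
    IsClassicalEulerSolutionOn (Iio (-c)) 0 (fun t => u (t + c)) (fun t => p (t + c)) := by
  have h := hcl.comp_add_right c
  have hS : ((· + c) ⁻¹' Iio (0 : ℝ)) = Iio (-c) := by
    ext t; simp only [mem_preimage, mem_Iio]; constructor <;> intro h <;> linarith
  rw [hS] at h
  exact h

/-- **CAUCHY'S FORMULA FROM ANY INITIAL TIME.**  Classical Euler on `(−∞,0)` with the Cauchy–Lipschitz hypotheses: for `t₀, t < 0`,
`ω(t, φ(t,t₀,a)) = Dφ(t,t₀,·)(a)·ω(t₀, a)`. [cite: MajdaBertozziCUP2002, §1.6 Prop. 1.8 eq. (1.51)] -/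
theorem curl_evolutionMap_any (hcl : IsClassicalEulerSolutionOn (Iio 0) 0 u p) (hL : ODE.IsUniformlyLipschitzOn u (Iio 0))
    {t₀ t : ℝ} (ht₀ : t₀ < 0) (ht : t < 0) (a : EuclideanSpace ℝ (Fin 3)) :
    curl (u t) (ODE.evolutionMap u t₀ t a) = fderiv ℝ (ODE.evolutionMap u t₀ t) a (curl (u t₀) a) := by
  have hcl' := isClassicalEulerSolutionOn_comp_add_right hcl t₀
  have hL' := isUniformlyLipschitzOn_comp_add_right hL t₀
  have h0 : (0 : ℝ) ∈ Iio (-t₀) := by rw [mem_Iio]; linarith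
  have ht' : t - t₀ ∈ Iio (-t₀) := by rw [mem_Iio]; linarith
  have h := hcl'.curl_evolutionMap (convex_Iio _) h0 (uniqueDiffOn_Iio _) hL' ht' a
  have hfun : ODE.evolutionMap (fun s => u (s + t₀)) 0 (t - t₀) = ODE.evolutionMap u t₀ t := by
    funext x
    rw [evolutionMap_comp_add_right_eq hL ht₀ (by linarith) x, sub_add_cancel]
  simpa [hfun, sub_add_cancel] using h

/-- **`det Dφ(t,t₀,·) = 1` FROM ANY INITIAL TIME** (incompressibility).  [cite: MajdaBertozziCUP2002, §1.3 Prop. 1.4 (ii) ⇒ (iii)] -/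
theorem det_fderiv_evolutionMap_any (hcl : IsClassicalEulerSolutionOn (Iio 0) 0 u p) (hL : ODE.IsUniformlyLipschitzOn u (Iio 0))
    {t₀ t : ℝ} (ht₀ : t₀ < 0) (ht : t < 0) (a : EuclideanSpace ℝ (Fin 3)) :
    (fderiv ℝ (ODE.evolutionMap u t₀ t) a).det = 1 := by
  have hcl' := isClassicalEulerSolutionOn_comp_add_right hcl t₀
  have hL' := isUniformlyLipschitzOn_comp_add_right hL t₀
  have h0 : (0 : ℝ) ∈ Iio (-t₀) := by rw [mem_Iio]; linarith
  have ht' : t - t₀ ∈ Iio (-t₀) := by rw [mem_Iio]; linarith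
  have h := hcl'.det_fderiv_evolutionMap_eq_one (convex_Iio _) h0 (uniqueDiffOn_Iio _) hL' ht' a
  have hfun : ODE.evolutionMap (fun s => u (s + t₀)) 0 (t - t₀) = ODE.evolutionMap u t₀ t := by
    funext x
    rw [evolutionMap_comp_add_right_eq hL ht₀ (by linarith) x, sub_add_cancel]
  rwa [hfun] at h

/-- The particle-trajectory maps between two times of `(−∞,0)` are smooth. [cite: Hartman2002, Ch. V Cor. 4.1] -/
theorem contDiff_evolutionMap_any (hcl : IsClassicalEulerSolutionOn (Iio 0) 0 u p) (hL : ODE.IsUniformlyLipschitzOn u (Iio 0))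
    {t₀ t : ℝ} (ht₀ : t₀ < 0) (ht : t < 0) : ContDiff ℝ ∞ (ODE.evolutionMap u t₀ t) :=
  contDiff_evolutionMap_slice hL hcl.smooth_velocity (convex_Iio 0) (uniqueDiffOn_Iio 0) (mem_Iio.2 ht₀) (mem_Iio.2 ht)

end Summit.NavierStokesRegularity.NavierStokesRegularity.Theorems.PowerGaugeEulerLiouville.DSSNodes

end
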